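import Summits.BirchSwinnertonDyer.BirchSwinnertonDyer.Theorems.MordellShaFreeCutThreeAdicBDPExistsValue
import Summits.BirchSwinnertonDyer.BirchSwinnertonDyer.Theorems.MordellShaFreeCutKatoZetaRoadPinnedH2
import Summits.BirchSwinnertonDyer.BirchSwinnertonDyer.Theorems.MordellShaFreeCutJZeroConductorThree
import Literature.NumberTheory.EllipticCurves.ComplexMultiplicationNotSemistable
import Literature.NumberTheory.EllipticCurves.ComplexMultiplicationHasCMProofs
import Literature.NumberTheory.EllipticCurves.ModularDegreeQuadraticTwistProofs
import Literature.NumberTheory.EllipticCurves.ModularCurveManinConstantProofs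
import Literature.NumberTheory.EllipticCurves.UnrIntegersUnits
import HarnessLib

set_option linter.dupNamespace false
set_option autoImplicit false

/-! # Route `MordellShaFreeCut` (rung S2b) — the ONE object shared by the two roads to crux B, typed at `p = 3`:
(ERL₃) «Kato ↔ BDP explicit reciprocity at the trivial character, up to a non-zero constant» over the EXACT
`R₀`-frame, and the census `PRFormulaAtThreeH2 ⟸ (LB-exist∧bdp)∃ ∧ (ERL₃)` with the (ι, P)-commensurability PROVED

Cell `bsd-cn100`, prover seat `bsd-cn100-s2b-c3` (g8) — the S2b / EXACT-frame twin of seat `bsd-cn100-s2-c3` g9's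
`Theorems/CongruentShaFreeCutKatoBDPReciprocityUpTo.lean` (p486660), token for token with `2 ↦ 3`,
`E_n ↦ W` (`j(W) = 0`, globally minimal), `IsBDPLFunctionUpTo C ↦ IsBDPLFunction` (at `p = 3` the EXACT frame
is the currency of the S2b road — plan g15 00:41:17Z (3) option (a), MEMO-12 ADD-A §A.4: the CH18 constants are
`3`-adic units). Plan g15 ruling 2026-08-27T00:41:17Z (1) («(ERL) over the EXISTING frame as ONE @[conjecture] def +
census … the commensurability of the statement's (ι, P) with the frame's reading PROVED from tree theorems, never
assumed»; (4) «PARTITION of files: s2b-c3 = S2b EXACT»), executable since the MEMO-13 labels are EFFECTIVE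
(ref g26 IX-P). Perrin-Riou's formula at the additive prime `3` (`stub_prFormulaAtThree : PRFormulaAtThreeH2`, the
research stub of the registered kato-zeta line on stmt-BirchSwinnertonDyer-19160) ⟸ (A1)+(A2) = the BDP element WITH
its value at 𝟙 (`ThreeAdicBDPElementExistsWithValue`, the registered EV∃ stub of stmt-19159, p478070) ∧ (A3) = a
RECIPROCITY LAW linking Kato's zeta class to the BDP value. Supports, does not close, stmt-19160.
THEOREMS + ONE `@[conjecture] def` (OPEN, nothing asserted); no named fact, no `sorry`.

* §1 `ThreeAdicKatoBDPReciprocity` — (ERL₃): for the frame data of EV∃ (`W` globally minimal with `j = 0`,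
  imaginary quadratic Heegner field `K` of level `N = N(W)` with `3 = v v̄`, `Dt`, `v ∋ 3`, anticyclotomic `κ`
  with topological generator `γ`) and `L(W, 1) = 0`: for EVERY admissible EXACT frame `(ι', Ω_K, Ω_p, 𝓛)`
  (`IsBDPLFunction ι' v κ γ Dt.f Ω_K Ω_p 𝓛`, `Ω_p ∈ R₀ˣ`, `𝓛 ∈ R₀⟦T⟧`) and EVERY pinned Kato descent datum
  `(D, pin)` of `(W, 3)` satisfying Main Conjecture 12.10 up to powers of `3`, there are `t ∈ ℚ₃` and `c ∈ ℂ₃ˣ`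
  with `HasLocPKummerLog W 3 pin.katoClass t` and `𝓛(𝟙) = c · t`. NO Heegner point occurs. In print this link
  exists ONLY as the corollary «Perrin-Riou's formula ∘ (BDP's formula)⁻¹» where both are known (good
  `p = v v̄ ∤ N`: BDP 2013 Thm. 5.13 / Castella–Hsieh 2018; BDV 2022 Thm. A, BSTW 2024 Thm. 1.13) — NOT at
  `(W, 3)`, `W` additive at `3`; it is the cell's (A3) at `p = 3`.
* §2 `prFormulaAtThreeH2_of_bdpExistsValue_of_reciprocity` — THE CENSUS: `PRFormulaAtThreeH2 ⟸ EV∃ ∧ (ERL₃)`,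
  NOTHING ELSE. Commensurability, PROVED: PR's embedding `ι : K → ℚ₃` and Heegner point `P` are moved to EV's
  reading through THE infinite place `w₀` by the Galois conjugate `P' = τ P` (`τ ∈ Gal(K/ℚ)` with
  `w₀ ∘ τ = ι_K`, as in p478070) and the embedding `e = ι ∘ τ⁻¹` (so that `log_ω^{e}(P') = log_ω^{ι}(P)`,
  `Affine.Point.map_map`), `v := inducedPlace e`, `(κ, γ)` from `X11b.exists_anticyclotomic_generator_degreeOnePrime`;
  EV∃ gives a frame with `𝓛(𝟙) = u·c_{Dt}⁻²·(1 − a₃/3 + [3 ∤ N]/3)²·log_ω(P)²`, (ERL₃) gives `𝓛(𝟙) = c·t`; by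
  uniqueness of the value, `a₃(W) = 0` (additive reduction: `MordellShaFreeCutJZeroConductorThree` + «CM ⇒ not
  multiplicative» + `LFunction_apply_eq_zero_of_not_good_of_not_mult`) and `3 ∣ N`
  (`three_dvd_conductorNorm_of_j_eq_zero`) the Euler-type factor is `1`, so `t = c_P · log_ω(P)²`, `c_P ∈ ℚ₃ˣ`.
* §3 `reciprocity_of_prFormula_of_valueAtOne` — CALIBRATION: (ERL₃) ⟸ `PRFormulaAtThreeH2` ∧ (LB-bdp) ∀-frame
  `ThreeAdicBDPValueAtOne` (landed def p439508) ∧ existence of Heegner points — (ERL₃) is «PR minus BDP».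

HONEST FRAMING: ONE named open statement + CONDITIONAL reductions; nothing here proves (ERL₃), EV∃,
`PRFormulaAtThreeH2`, crux A, crux B, the leaf `rankOne_threeConverse_mordellCurve`, Sylvester's conjecture or
any case of BSD. PARTITION: none — RANK axis.

[cite: AlpogeBhargavaShnidman2022, App. A Thm. 10.8 (a) (p. 33) and §2 after Thm. 2.10 (shape of PR's formula; the gap)]
[cite: BertoliniDarmonPrasanna2013, Thm. 5.13 (shape of the value at the trivial character)]
[cite: BertoliniDarmonVenerucci2022, Thm. A (PR's conjecture at semistable odd p)]
[cite: CastellaGrossiLeeSkinner2022, §2 (the place induced by ι_p)]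
-/

noncomputable section

open scoped Classical

namespace Summit.BirchSwinnertonDyer.BirchSwinnertonDyer.Theorems.MordellShaFreeCutKatoBDPReciprocity

open PowerSeries WeierstrassCurve NumberField IsDedekindDomain Field Literature.NumberTheory.EllipticCurves
  Literature.NumberTheory.EllipticCurves.ModularForms Literature.NumberTheory.QuadraticFields
  Literature.NumberTheory.EllipticCurves.Castella2018 Literature.NumberTheory.EllipticCurves.Kato2004
open Literature.NumberTheory.GaloisRepresentations Literature.NumberTheory.GaloisCohomology
open Summit.BirchSwinnertonDyer.BirchSwinnertonDyer.Theses.MordellShaFreeCut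
open Summit.BirchSwinnertonDyer.BirchSwinnertonDyer.Theorems.MordellShaFreeCutThreeAdicBDPExistsValue
  (ThreeAdicBDPElementExistsWithValue)
open Summit.BirchSwinnertonDyer.BirchSwinnertonDyer.Theorems.MordellShaFreeCutThreeAdicBDPTriple
  (ThreeAdicBDPValueAtOne)
open Summit.BirchSwinnertonDyer.Rank1Residual.Additive (KatoDescentDatum)
open Summit.BirchSwinnertonDyer.BirchSwinnertonDyer.Theorems.CongruentShaFreeCutKatoDescentDatumOfH2
open Summit.BirchSwinnertonDyer.BirchSwinnertonDyer.Theorems.MordellShaFreeCutKatoZetaRoadPinnedH2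
  (PRFormulaAtThreeH2)
open Summit.BirchSwinnertonDyer.BirchSwinnertonDyer.Theorems.MordellShaFreeCutJZeroConductorThree
  (three_dvd_conductorNorm_of_j_eq_zero not_hasGoodReductionAtPrime_three_of_j_eq_zero)

/-! ## §0 `a₃(W) = 0` and the Euler-type factor of the value display is `1` -/

/-- **`a₃(W) = 0` for every globally minimal elliptic `W/ℚ` with `j(W) = 0`**: `W` is bad at `3`
(`not_hasGoodReductionAtPrime_three_of_j_eq_zero`) and, having CM (`hasCM_of_j_eq_zero`), never multiplicative
(`not_hasMultiplicativeReductionAtPrime_of_hasCM`), so additive, and `a_p = 0` at an additive prime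
(`LFunction_apply_eq_zero_of_not_good_of_not_mult`). [cite: SilvermanAEC2009, VII.5 Prop. 5.1 and App. C §16]
[cite: SilvermanATAEC1994, Thm. II.6.4 (PDF p. 148)] -/
theorem lFunction_three_eq_zero_of_j_eq_zero (W : WeierstrassCurve ℚ) [W.IsElliptic] [W.IsGloballyMinimal]
    (hj : W.j = 0) : W.LFunction 3 = 0 :=
  haveI : Fact (Nat.Prime 3) := ⟨Nat.prime_three⟩
  W.LFunction_apply_eq_zero_of_not_good_of_not_mult 3 (not_hasGoodReductionAtPrime_three_of_j_eq_zero W hj)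
    (W.not_hasMultiplicativeReductionAtPrime_of_hasCM (W.hasCM_of_j_eq_zero hj) 3) (dvd_refl 3)

/-- **The constant of the BDP value display at `j = 0` is `c_{Dt}⁻²` and is non-zero**: `a₃ = 0` and `3 ∣ N`
make the Euler-type factor `1 − a₃/3 + [3 ∤ N]/3` equal to `1`; the Manin constant is non-zero
(`ModularParametrizationData.maninConstant_ne_zero_holds`). [folklore] -/
theorem valueConstant_ne_zero (W : WeierstrassCurve ℚ) [W.IsElliptic] [W.IsGloballyMinimal] (hj : W.j = 0)
    {N : ℕ} [NeZero N] (Dt : ModularParametrizationData W N) (hN : W.conductorNorm ℤ = N) :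
    ((Dt.c : ℚ_[3])⁻¹) ^ 2 *
      (1 - (W.LFunction 3 : ℚ_[3]) * (3 : ℚ_[3])⁻¹ + (if (3 : ℕ) ∣ N then 0 else (3 : ℚ_[3])⁻¹)) ^ 2 ≠ 0 := by
  have h3N : 3 ∣ N := hN ▸ three_dvd_conductorNorm_of_j_eq_zero W hj
  rw [lFunction_three_eq_zero_of_j_eq_zero W hj, if_pos h3N]
  refine mul_ne_zero (pow_ne_zero _ (inv_ne_zero ?_)) (pow_ne_zero _ ?_)
  · exact_mod_cast Dt.maninConstant_ne_zero_holds
  · push_cast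
    norm_num

/-! ## §1 (ERL₃) — the Kato ↔ BDP reciprocity at 𝟙, up to a non-zero constant (OPEN; named, nothing asserted) -/

/-- (ERL₃) — **the `3`-adic Kato ↔ BDP EXPLICIT RECIPROCITY AT THE TRIVIAL CHARACTER, UP TO A NON-ZERO
CONSTANT, over the EXACT `R₀`-frame**, for the newform `Dt.f` of a globally minimal `W/ℚ` with `j(W) = 0` over
an imaginary quadratic Heegner field `K` of level `N = N(W)` with `3 = v v̄` split (Heegner for `3`) and
`L(W^{(d_K)}, 1) ≠ 0` — the Heegner fields of `PRFormulaAtThreeH2` ([ABS] §10.1.3) —, an anticyclotomic `κ` with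
topological generator `γ`, and `L(W, 1) = 0`: for EVERY embedding datum `ι' : ℚ̄₃ ≃ ℂ` inducing `v`, EVERY
admissible exact frame `(Ω_K ≠ 0, Ω_p ∈ R₀ˣ, 𝓛 ∈ R₀⟦T⟧)` with `IsBDPLFunction ι' v κ γ Dt.f Ω_K Ω_p 𝓛`, and EVERY
PINNED Kato descent datum `(D, pin)` of `(W, 3)` satisfying Kato's Main Conjecture 12.10 up to powers of `3`,
there are `t ∈ ℚ₃` and `c ∈ ℂ₃`, `c ≠ 0`, such that the localisation at `3` of the pinned Kato class is a Kummer
class of logarithm `t` (`HasLocPKummerLog W 3 pin.katoClass t`, Bloch–Kato / [ABS] §10.1.2 currency) and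
`𝓛(𝟙) = c · t` (`UnrSeries.HasValueAt 𝓛 0 (c · t)`). The cell's (A3) at `p = 3`: NO Heegner point occurs; in
print ONLY as the corollary PR ∘ BDP⁻¹ at good split `p ∤ N` (PR: BDV 2022 Thm. A / BSTW 2024 Thm. 1.13; BDP:
BDP 2013 Thm. 5.13) — OPEN at the additive prime `3` of a `j = 0` curve; nothing asserted. Modulo EV∃ at its frame
it is equivalent to `PRFormulaAtThreeH2` there (§2 proves «⟹» for all frames, §3 «⟸» given (LB-bdp)). The S2
twin is `CongruentShaFreeCutKatoBDPReciprocityUpTo.TwoAdicKatoBDPReciprocityUpTo` (♯-frame).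
[cite: AlpogeBhargavaShnidman2022, App. A Thm. 10.8 (a) (p. 33) (shape; nothing asserted at p = 3 ∣ N)]
[cite: BertoliniDarmonPrasanna2013, Thm. 5.13 (shape)] [cite: BertoliniDarmonVenerucci2022, Thm. A (shape at semistable odd p)] -/
@[conjecture] def ThreeAdicKatoBDPReciprocity : Prop :=
  ∀ (W : WeierstrassCurve ℚ) [W.IsElliptic] [W.IsGloballyMinimal]
    [ContinuousSMul ℤ_[3] (W.tateModule 3)], W.j = 0 →
    ∀ (K : Type) [Field K] [NumberField K] (N : ℕ) [NeZero N]
      (Dt : ModularParametrizationData W N)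
      (v : HeightOneSpectrum (𝓞 K)) (κ : ZpExtension K 3) (γ : absoluteGaloisGroup K)
      [Fact (κ.IsTopGenerator γ)],
    W.conductorNorm ℤ = N → IsImaginaryQuadratic K →
    SatisfiesHeegnerHypothesis N K → SatisfiesHeegnerHypothesis 3 K →
    (W.quadraticTwist (NumberField.discr K : ℚ)).entireLFunction 1 ≠ 0 →
    ((Ideal.span {(3 : ℤ)}).primesOver (𝓞 K)).ncard = 2 →
    ((3 : ℕ) : 𝓞 K) ∈ v.asIdeal → κ.IsAnticyclotomic →
    W.entireLFunction 1 = 0 →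
    ∀ (ι' : PadicAlgCl 3 ≃+* ℂ),
      (∀ (w' : InfinitePlace K) (k : 𝓞 K), k ∈ v.asIdeal ↔ ‖ι'.symm (w'.embedding (k : K))‖ < 1) →
    ∀ (ΩK : ℂ) (Ωp : (unrIntegers 3)ˣ) (L : UnrSeries 3),
      ΩK ≠ 0 → IsBDPLFunction ι' v κ γ Dt.f ΩK ((Ωp : unrIntegers 3) : ℂ_[3]) L →
    ∀ (D : KatoDescentDatum 3) (pin : KatoDescentDatumPinH2 W 3 D),
      (∃ a b : ℕ,
        Ideal.span {((3 : ℕ) : IwasawaAlgebra 3) ^ a} * Module.charIdeal (IwasawaAlgebra 3) D.H2 =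
          Ideal.span {((3 : ℕ) : IwasawaAlgebra 3) ^ b} *
            Module.charIdeal (IwasawaAlgebra 3) (D.H ⧸ (IwasawaAlgebra 3) ∙ D.z)) →
      ∃ (t : ℚ_[3]) (c : ℂ_[3]), c ≠ 0 ∧
        HasLocPKummerLog W 3 pin.katoClass t ∧
        L.HasValueAt 0 (c * algebraMap ℚ_[3] ℂ_[3] t)

/-! ## §2 The census: `PRFormulaAtThreeH2 ⟸ EV∃ ∧ (ERL₃)` with the commensurability proved -/

/-- `log_ω` of the `ρ`-image of a point read along `ι` is `log_ω` of the point read along `ι ∘ ρ` (the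
underlying `ℚ₃`-point is the same: `Affine.Point.map_map`). [folklore] -/
theorem padicLogOmega_map (W : WeierstrassCurve ℚ) [W.IsElliptic] [W.IsGloballyMinimal]
    {K : Type} [Field K] [NumberField K]
    (ι : K →+* ℚ_[3]) (ρ : K →+* K) (P : (W.baseChange K).toAffine.Point) :
    padicLogOmega W 3 ι (WeierstrassCurve.Affine.Point.map ρ.toRatAlgHom P) =
      padicLogOmega W 3 (ι.comp ρ) P := by
  unfold padicLogOmega padicPointOf
  rw [WeierstrassCurve.Affine.Point.map_map]
  rfl

/-- `log_ω` read along `ι ∘ σ` of the `σ⁻¹`-conjugate point is `log_ω` read along `ι` (the underlying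
`ℚ₃`-point is the same: `Affine.Point.map_map`). [folklore] -/
theorem padicLogOmega_comp_map_symm (W : WeierstrassCurve ℚ) [W.IsElliptic] [W.IsGloballyMinimal]
    {K : Type} [Field K] [NumberField K]
    (ι : K →+* ℚ_[3]) (σ : K ≃ₐ[ℚ] K) (P : (W.baseChange K).toAffine.Point) :
    padicLogOmega W 3 (ι.comp (σ : K →+* K))
        (WeierstrassCurve.Affine.Point.map ((σ.symm : K ≃ₐ[ℚ] K) : K →+* K).toRatAlgHom P) =
      padicLogOmega W 3 ι P := by
  unfold padicLogOmega padicPointOf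
  rw [WeierstrassCurve.Affine.Point.map_map]
  have hcomp : (ι.comp (σ : K →+* K)).toRatAlgHom.comp ((σ.symm : K ≃ₐ[ℚ] K) : K →+* K).toRatAlgHom =
      ι.toRatAlgHom := by
    apply AlgHom.ext
    intro x
    change ι (σ (σ.symm x)) = ι x
    rw [AlgEquiv.apply_symm_apply]
  rw [hcomp]

/-- **THE CENSUS — Perrin-Riou's formula at `3` follows from the BDP element with its value (EV∃, registered on
stmt-19159) and the Kato ↔ BDP reciprocity (ERL₃), NOTHING ELSE.** For PR's data (`W` with `j = 0`, Heegner field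
`K` for `N` and for `3`, `ι : K → ℚ₃`, Heegner point `P`, `L(W,1) = 0`, pinned datum with MC): conjugate the Heegner
reading to THE infinite place `w₀` (`P' = τP`, `e = ι ∘ τ⁻¹`, `log_ω^{e} P' = log_ω^{ι} P`), take
`v = inducedPlace e` and an anticyclotomic `(κ, γ)`; EV∃ gives an admissible frame with
`𝓛(𝟙) = u · c_{Dt}⁻² · (1 − a₃/3 + [3 ∤ N]/3)² · log_ω(P)²`, (ERL₃) gives `𝓛(𝟙) = c · t` with `loc₃` of the Kato
class a Kummer class of logarithm `t`; by uniqueness of the value and `a₃(W) = 0`, `3 ∣ N`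
(`valueConstant_ne_zero`), `t = c_P · log_ω(P)²` with `c_P ∈ ℚ₃ˣ` (if `log_ω P = 0` then `t = 0` and any `c_P`
serves). CONDITIONAL; credits nothing beyond the reduction.
[cite: AlpogeBhargavaShnidman2022, App. A Thm. 10.8 (a) (p. 33) and §10.1.2–§10.1.3]
[cite: CastellaGrossiLeeSkinner2022, §2 (the place induced by ι_p)] -/
theorem prFormulaAtThreeH2_of_bdpExistsValue_of_reciprocity
    (hEV : ThreeAdicBDPElementExistsWithValue) (hERL : ThreeAdicKatoBDPReciprocity) :
    PRFormulaAtThreeH2 := by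
  intro W _ _ _ hj K _ _ N _ hN hK hHN hH3 hLtw ι P hP hL1 D pin hMC
  haveI : Fact (Nat.Prime 3) := ⟨Nat.prime_three⟩
  -- (0) `3 = v v̄` splits in `K`
  have hsplit : ((Ideal.span {(3 : ℤ)}).primesOver (𝓞 K)).ncard = 2 := by
    simpa using hH3 3 Nat.prime_three (dvd_refl 3)
  -- (1) the Heegner reading of `P`, conjugated to THE infinite place `w₀`
  obtain ⟨Dt, H, ιK, hPι⟩ := hP
  obtain ⟨w₀⟩ := (inferInstance : Nonempty (InfinitePlace K))
  haveI : IsGalois ℚ K := by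
    haveI : Algebra.IsQuadraticExtension ℚ K := ⟨hK.1⟩
    infer_instance
  obtain ⟨σ, hσ⟩ := ComplexEmbedding.exists_comp_symm_eq_of_comp_eq (k := ℚ) w₀.embedding ιK
    (by ext x; simp)
  set τ : K →+* K := ((σ.symm : K ≃ₐ[ℚ] K) : K →+* K) with hτdef
  set P' := WeierstrassCurve.Affine.Point.map τ.toRatAlgHom P with hP'def
  have hP' : WeierstrassCurve.Affine.Point.map w₀.embedding.toRatAlgHom P' =
      heegnerPointComplex Dt H := by
    rw [hP'def, WeierstrassCurve.Affine.Point.map_map]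
    have hcomp : w₀.embedding.toRatAlgHom.comp τ.toRatAlgHom = ιK.toRatAlgHom := by
      apply AlgHom.ext
      intro x
      have := RingHom.congr_fun hσ x
      simpa [hτdef] using this
    rw [hcomp]
    exact hPι
  -- (2) the embedding `e = ι ∘ τ⁻¹`, its induced place `v ∋ 3`, an anticyclotomic `(κ, γ)`
  set e : K →+* ℚ_[3] := ι.comp (σ : K →+* K) with hedef
  have hlog : padicLogOmega W 3 e P' = padicLogOmega W 3 ι P := padicLogOmega_comp_map_symm W ι σ P
  set v := Summit.BirchSwinnertonDyer.Rank1Residual.X11b.inducedPlace e with hvdef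
  have hv : ∀ x : 𝓞 K, x ∈ v.asIdeal ↔ ‖e (x : K)‖ < 1 :=
    Summit.BirchSwinnertonDyer.Rank1Residual.X11b.mem_inducedPlace_iff e
  have hv3 : ((3 : ℕ) : 𝓞 K) ∈ v.asIdeal :=
    Summit.BirchSwinnertonDyer.Rank1Residual.X11b.natCast_mem_inducedPlace e
  obtain ⟨κ, γ, -, hκ, hγ, -, -, -⟩ :=
    Summit.BirchSwinnertonDyer.Rank1Residual.X11b.exists_anticyclotomic_generator_degreeOnePrime
      3 K hK hH3
  haveI : Fact (κ.IsTopGenerator γ) := ⟨hγ⟩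
  -- (3) EV∃ at `(Dt, H, w₀, e, v, κ, γ, P')`: ONE exact frame WITH its value at `𝟙`
  obtain ⟨ι', hι', ΩK, Ωp, L, hΩK, hBDP, u, hu⟩ :=
    hEV W hj K N Dt H w₀ e v κ γ P' hN hK hHN hsplit hv3 hκ hP' hv
  have hu0 : (((u : (unrIntegers 3)ˣ) : unrIntegers 3) : ℂ_[3]) ≠ 0 := by
    intro h0
    have h1 := (unrIntegers.isUnit_iff_norm_eq_one _).1 u.isUnit
    rw [h0, norm_zero] at h1
    exact zero_ne_one h1
  -- (4) (ERL₃) at the same frame and the given pinned datum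
  obtain ⟨t, c, hc0, hKum, ht⟩ :=
    hERL W hj K N Dt v κ γ hN hK hHN hH3 hLtw hsplit hv3 hκ hL1 ι' hι' ΩK Ωp L hΩK hBDP D pin hMC
  -- (5) compare the two values at `𝟙`
  have heq := ht.unique hu
  rw [hlog] at heq
  set A : ℚ_[3] := ((Dt.c : ℚ_[3])⁻¹) ^ 2 *
      (1 - (W.LFunction 3 : ℚ_[3]) * (3 : ℚ_[3])⁻¹ + (if (3 : ℕ) ∣ N then 0 else (3 : ℚ_[3])⁻¹)) ^ 2
    with hAdef
  have hA0 : A ≠ 0 := valueConstant_ne_zero W hj Dt hN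
  -- (6) the constant `c_P`
  by_cases hlog0 : padicLogOmega W 3 ι P = 0
  · -- torsion-type case: `𝓛(𝟙) = 0`, so `t = 0`; any constant serves
    refine ⟨1, one_ne_zero, ?_⟩
    have ht0 : t = 0 := by
      have h1 : (c : ℂ_[3]) * algebraMap ℚ_[3] ℂ_[3] t = 0 := by
        rw [heq, hlog0]; simp
      rcases mul_eq_zero.mp h1 with h | h
      · exact absurd h hc0
      · exact (map_eq_zero_iff _ (algebraMap ℚ_[3] ℂ_[3]).injective).mp h
    rw [hlog0]
    simpa [ht0] using hKum
  · refine ⟨t / padicLogOmega W 3 ι P ^ 2, ?_, ?_⟩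
    · -- `c_P ≠ 0`: `t ≠ 0` since `c · t = u · A · log² ≠ 0`
      have ht0 : t ≠ 0 := by
        intro h0
        rw [h0, map_zero, mul_zero] at heq
        have h1 : (((u : (unrIntegers 3)ˣ) : unrIntegers 3) : ℂ_[3]) *
            algebraMap ℚ_[3] ℂ_[3] (A * padicLogOmega W 3 ι P ^ 2) = 0 := by
          rw [hAdef]; exact heq.symm
        rcases mul_eq_zero.mp h1 with h | h
        · exact hu0 h
        · rw [map_eq_zero_iff _ (algebraMap ℚ_[3] ℂ_[3]).injective] at h
          exact (mul_ne_zero hA0 (pow_ne_zero 2 hlog0)) h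
      exact div_ne_zero ht0 (pow_ne_zero 2 hlog0)
    · rw [div_mul_cancel₀ t (pow_ne_zero 2 hlog0)]
      exact hKum

/-! ## §3 Calibration: (ERL₃) ⟸ `PRFormulaAtThreeH2` ∧ (LB-bdp) ∧ Heegner points — the new statement is
EXACTLY the residue of Perrin-Riou's formula after the BDP value formula, not more -/

/-- **(ERL₃) is not stronger than «PR ∧ BDP»**: Perrin-Riou's formula `PRFormulaAtThreeH2` together with the
∀-frame value formula (LB-bdp) `ThreeAdicBDPValueAtOne` (landed def; its surplus over EV∃ is the character supply,
a tree theorem) and the existence of Heegner points (refereed fact, Gross 1984) imply (ERL₃): at a frame for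
`(v, Dt)` read PR at the embedding `e ∘ τ` attached to the DEGREE-ONE prime `v` (`X11b.embAt`, `τ ∈ Gal(K/ℚ)`
conjugating the Heegner reading to THE infinite place) and a Heegner point `P`, getting `t = c_P · log_ω(P)²`, and
(LB-bdp) at the reading `(w₀, e, τP)`, getting `𝓛(𝟙) = u·A·log_ω(P)²` (`A = c_{Dt'}⁻²`, the Euler-type factor
being `1` and the newform unique, `IsNewformOf.unique`); so `𝓛(𝟙) = (u·A·c_P⁻¹) · t`. With §2 this makes
(ERL₃) ⟺ PR modulo the BDP side. CONDITIONAL; credits nothing. [cite: AlpogeBhargavaShnidman2022, App. A Thm. 10.8 (a) (p. 33)]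
[cite: Gross1984, §§3–4 (Heegner points)] -/
theorem reciprocity_of_prFormula_of_valueAtOne
    (hHP : ∀ (W : WeierstrassCurve ℚ) (K : Type) [Field K] [NumberField K], exists_isHeegnerPoint W K)
    (hPR : PRFormulaAtThreeH2) (hV : ThreeAdicBDPValueAtOne) : ThreeAdicKatoBDPReciprocity := by
  intro W _ _ _ hj K _ _ N _ Dt v κ γ _ hN hK hHN hH3 hLtw hsplit hv3 hκ hL1 ι' hι' ΩK Ωp L hΩK hBDP D pin hMC
  haveI : Fact (Nat.Prime 3) := ⟨Nat.prime_three⟩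
  subst hN
  -- (1) the embedding at the degree-one prime `v ∋ 3`
  have hsplit' : Summit.BirchSwinnertonDyer.Rank1Residual.X11b.SplitsIn K 3 :=
    hH3 3 Nat.prime_three (dvd_refl 3)
  obtain ⟨he1, hf1⟩ :=
    Summit.BirchSwinnertonDyer.Rank1Residual.X11b.degreeOne_of_splitsIn hK.1 hsplit' hv3
  set e : K →+* ℚ_[3] := Summit.BirchSwinnertonDyer.Rank1Residual.X11b.embAt K 3 v hv3 he1 hf1 with hedef
  have he : ∀ k : 𝓞 K, k ∈ v.asIdeal ↔ ‖e (k : K)‖ < 1 :=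
    Summit.BirchSwinnertonDyer.Rank1Residual.X11b.mem_asIdeal_iff_norm_embAt_lt_one v hv3 he1 hf1
  -- (2) a Heegner point and its reading through THE infinite place
  obtain ⟨P, Dt', H, ιK, hPι⟩ := hHP W K hK hHN
  obtain ⟨w₀⟩ := (inferInstance : Nonempty (InfinitePlace K))
  haveI : IsGalois ℚ K := by
    haveI : Algebra.IsQuadraticExtension ℚ K := ⟨hK.1⟩
    infer_instance
  obtain ⟨σ, hσ⟩ := ComplexEmbedding.exists_comp_symm_eq_of_comp_eq (k := ℚ) w₀.embedding ιK
    (by ext x; simp)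
  set τ : K →+* K := ((σ.symm : K ≃ₐ[ℚ] K) : K →+* K) with hτdef
  set P' := WeierstrassCurve.Affine.Point.map τ.toRatAlgHom P with hP'def
  have hP' : WeierstrassCurve.Affine.Point.map w₀.embedding.toRatAlgHom P' =
      heegnerPointComplex Dt' H := by
    rw [hP'def, WeierstrassCurve.Affine.Point.map_map]
    have hcomp : w₀.embedding.toRatAlgHom.comp τ.toRatAlgHom = ιK.toRatAlgHom := by
      apply AlgHom.ext
      intro x
      have := RingHom.congr_fun hσ x
      simpa [hτdef] using this
    rw [hcomp]
    exact hPι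
  -- (3) PR at `(e ∘ τ, P)`: `t := c_P · log_ω(P)²`
  obtain ⟨cP, hcP0, hKum⟩ := hPR W hj K (W.conductorNorm ℤ) rfl hK hHN hH3 hLtw (e.comp τ) P
    ⟨Dt', H, ιK, hPι⟩ hL1 D pin hMC
  -- (4) (LB-bdp) at the reading `(w₀, e, P')` and the frame (for `Dt'.f = Dt.f`)
  have hff : Dt'.f = Dt.f := Dt'.isNewformOf.unique Dt.isNewformOf
  have hBDP' : IsBDPLFunction ι' v κ γ Dt'.f ΩK ((Ωp : unrIntegers 3) : ℂ_[3]) L := by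
    rw [hff]; exact hBDP
  obtain ⟨u, hu⟩ := hV W hj ι' K _ Dt' H w₀ e v κ γ P' rfl hK hHN hsplit hv3 hι' hκ hP' he ΩK Ωp L hΩK
    hBDP'
  rw [hP'def, padicLogOmega_map] at hu
  have hu0 : (((u : (unrIntegers 3)ˣ) : unrIntegers 3) : ℂ_[3]) ≠ 0 := by
    intro h0
    have h1 := (unrIntegers.isUnit_iff_norm_eq_one _).1 u.isUnit
    rw [h0, norm_zero] at h1
    exact zero_ne_one h1
  -- (5) the constant
  set A : ℚ_[3] := ((Dt'.c : ℚ_[3])⁻¹) ^ 2 *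
      (1 - (W.LFunction 3 : ℚ_[3]) * (3 : ℚ_[3])⁻¹ +
        (if (3 : ℕ) ∣ W.conductorNorm ℤ then 0 else (3 : ℚ_[3])⁻¹)) ^ 2 with hAdef
  have hA0 : A ≠ 0 := valueConstant_ne_zero W hj Dt' rfl
  refine ⟨cP * padicLogOmega W 3 (e.comp τ) P ^ 2,
    (((u : (unrIntegers 3)ˣ) : unrIntegers 3) : ℂ_[3]) * algebraMap ℚ_[3] ℂ_[3] (A * cP⁻¹), ?_, hKum, ?_⟩
  · refine mul_ne_zero hu0 ?_
    rw [map_ne_zero_iff _ (algebraMap ℚ_[3] ℂ_[3]).injective]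
    exact mul_ne_zero hA0 (inv_ne_zero hcP0)
  · have hrew : (((u : (unrIntegers 3)ˣ) : unrIntegers 3) : ℂ_[3]) * algebraMap ℚ_[3] ℂ_[3] (A * cP⁻¹) *
        algebraMap ℚ_[3] ℂ_[3] (cP * padicLogOmega W 3 (e.comp τ) P ^ 2) =
        (((u : (unrIntegers 3)ˣ) : unrIntegers 3) : ℂ_[3]) *
          algebraMap ℚ_[3] ℂ_[3] (A * padicLogOmega W 3 (e.comp τ) P ^ 2) := by
      rw [mul_assoc, ← map_mul]
      congr 2
      field_simp
    rw [hrew, hAdef]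
    exact hu

end Summit.BirchSwinnertonDyer.BirchSwinnertonDyer.Theorems.MordellShaFreeCutKatoBDPReciprocity

end
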